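import Summits.QuantumFields.YangMills.Theorems.BalabanLadderUVSeamRecCeilingsSeamReduction
import Summits.QuantumFields.YangMills.Theorems.BalabanLadderUVSeamRecClassicalResponseGlue
import HarnessLib

/-!
# Crux `UVSeamRec` (stmt-QuantumFields-20043), v5(α) stub `stub_responseMomentsOdd6` (RM): the v6(β-cl) glue with the large-field moment hypothesis
# asked for REDUCED cube families only — (split-cl) + (GD) + (EM_I)_red ⇒ `ResponseMomentsOdd6SU2`

Helper file (`--supports stmt-QuantumFields-20043`) of the width-lever seat `ym-20043-ceilings-p2` (lane B, gen 3); the minimal seam-aware variant of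
the LEAD's v6(β-cl) glue p548409 `ClassicalResponse.responseMomentsOdd6SU2_of_backgroundField_and_gaussianDomination`: identical constants and
mechanism (`C := max C_s (4v₁+1)`, `splitCl_rescale`, `emLin_rescale`, Hubbard–Stratonovich `emQ_of_subGaussianLinear`), but the doubled joint
exponential moment of tempered-d1's influence functional — LEAD's `EMI`, there asked for ALL representatives `x : Fin n → ℤ⁴` — is asked only for
REDUCED families `|x i c| ≤ L`, which suffices by this seat's seam reduction (p552799 `responseMoments_of_quadratic_and_reducedLF`: the (RM) body sees
the centres only modulo the period).  Why it matters: on tori with `b^k ∤ 2L+1` the grid shells of cyclically close cubes with different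
representatives are mutually misaligned, and single-scale product laws supply the influence moments with a UNIFORM constant only for reduced
families (≤ 16 sign classes; `…CeilingsWindowCellLaws`, p554392) — so (EM_I)_red is the suppliable form of (EM_I) (note LANE-B-g3 §7).
* `responseMomentsOdd6SU2_of_splitCl_gaussianDomination_reducedEMI`.
HONEST FRAMING: composition; (split-cl), (GD), (EM_I)_red are OPEN renormalisation-group statements; nothing of E0′; not a gap, not Clay.
References: folklore.
-/

set_option autoImplicit false

noncomputable section

open MeasureTheory Filter Topology Finset
open Literature.Probability.LatticeModels
open Literature.MathematicalPhysics.QuantumFieldTheory (GaugeConfig LatticeRep)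
open Literature.MathematicalPhysics.QuantumLattice
open Summit.QuantumFields.YangMills.Cruxes.OSLegsFromFemtoAndGap.DlrCollarTransfer
open Summit.QuantumFields.YangMills.Cruxes.UVSeamRec.ClassicalResponse
open Summit.QuantumFields.YangMills.Cruxes.UVSeamRec.PolymerData

namespace Summit.QuantumFields.YangMills.Cruxes.UVSeamRec.TemperedResponse

/-- **THE v6(β-cl) GLUE WITH (EM_I) ON REDUCED FAMILIES ONLY.**  Tempering data `𝔟, ε, kmax`, constants `C_s > 0`, `C₁ > 0`, `A₀ ≥ 0`, `ℓ₁ > 0`,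
bounded reference values `p`, with the LEAD's (split-cl) `SplitCl 𝔟 ε kmax C_s C₁ A₀ β₁ ℓ₁ p` and (GD) `GaussianDominationSU2`, and (EM_I)_red: for
`β ≥ β₁`, every odd torus, every REDUCED (`|x i c| ≤ L`) cyclically separated family at the unit of record and every `T`,
`⟨exp(2 Σ_{i∈T} influenceAt 𝔟 ε kmax β R (q i) (x i)∘lift)⟩_{2L+1,β} ≤ exp(B_I·#T)`.  THEN `ResponseMomentsOdd6SU2`. [folklore] -/
theorem responseMomentsOdd6SU2_of_splitCl_gaussianDomination_reducedEMI
    (𝔟 : BlockSize) (ε : ℝ → ℕ → ℝ) (kmax : ℝ → ℕ → ℕ) {C_s C₁ A₀ P₀ β₁ ℓ₁ B_I : ℝ} {p : Fin 4 × Fin 4 → ℝ → ℝ}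
    (hCs : 0 < C_s) (hC₁ : 0 < C₁) (hA₀ : 0 ≤ A₀) (hℓ₁ : 0 < ℓ₁) (hp : ∀ q β, |p q β| ≤ P₀)
    (hsplit : SplitCl 𝔟 ε kmax C_s C₁ A₀ β₁ ℓ₁ p) (hGD : GaussianDominationSU2)
    (hEMIred : ∀ β : ℝ, β₁ ≤ β → ∀ (L n : ℕ) (q : Fin n → Fin 4 × Fin 4) (x : Fin n → (Fin 4 → ℤ)) (R : ℕ),
      (∀ i, (q i).1 < (q i).2) → 1 ≤ R → (R : ℝ) * Transport.uRec β ≤ ℓ₁ → 4 * R + 8 ≤ L →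
      (∀ i c, |x i c| ≤ (L : ℤ)) →
      (∀ i j : Fin n, i ≠ j → ∃ k : Fin 4,
        (2 * (R : ℤ) + 4) ≤ |((((x i k - x j k : ℤ) : ZMod (2 * L + 1))).valMinAbs : ℤ)|) →
      ∀ T : Finset (Fin n),
        torusE (Matrix.specialUnitaryGroup (Fin 2) ℂ) (fundamentalLatticeRep 2) β L
          (fun U => Real.exp (((2 : ℕ) : ℝ) * ∑ i ∈ T, influenceAt (N := 2) 𝔟 ε kmax β R (q i) (x i) U)) ≤
          Real.exp (B_I * T.card)) :
    ResponseMomentsDefs.ResponseMomentsOdd6SU2 := by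
  obtain ⟨m₁, v₁, β₁', ℓ₁', hℓ₁', hEM⟩ := hGD
  -- constants (as in the LEAD's glue)
  set C : ℝ := max C_s (4 * v₁ + 1) with hCdef
  have hCsC : C_s ≤ C := le_max_left _ _
  have hCpos : 0 < C := hCs.trans_le hCsC
  have h4v : 4 * (v₁ / C) < 1 := by
    rw [mul_div_assoc', div_lt_one hCpos]
    have : 4 * v₁ + 1 ≤ C := le_max_right _ _
    linarith
  set β₀ : ℝ := max (max β₁ β₁') 0 with hβ₀
  have hβ₀₁ : β₁ ≤ β₀ := (le_max_left _ _).trans (le_max_left _ _)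
  have hβ₀₁' : β₁' ≤ β₀ := (le_max_right _ _).trans (le_max_left _ _)
  have hβ₀0 : 0 ≤ β₀ := le_max_right _ _
  set ℓ₀ : ℝ := min ℓ₁ ℓ₁' with hℓ₀
  have hℓ₀pos : 0 < ℓ₀ := lt_min hℓ₁ hℓ₁'
  set rF : LatticeRep (Matrix.specialUnitaryGroup (Fin 2) ℂ) := fundamentalLatticeRep 2 with hrF
  -- rescaled laws
  have hsplitC := splitCl_rescale hCs hCsC hA₀ hsplit
  have hEMC := emLin_rescale hCpos hEM
  -- the quadratic carrier and its linear statistic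
  set Q : ℝ → ℕ → Fin 4 × Fin 4 → (Fin 4 → ℤ) → LGConfig 4 (Matrix.specialUnitaryGroup (Fin 2) ℂ) → ℝ :=
    fun β R q x η => carrierCl rF C 1 β R q x η with hQdef
  set ℓ : ℝ → ℕ → Fin 4 × Fin 4 → (Fin 4 → ℤ) → LGConfig 4 (Matrix.specialUnitaryGroup (Fin 2) ℂ) → ℝ :=
    fun β R q x η => Real.sqrt (carrierCl rF C 1 β R q x η) with hℓdef
  have hℓm : ∀ β R q x, Measurable (ℓ β R q x) := fun β R q x => (measurable_carrierCl (r := rF) C 1 β R q x).sqrt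
  have hℓb : ∀ β R q x η, |ℓ β R q x η| ≤ Real.sqrt (|β| * (R : ℝ) ^ 4 / |C| * (2 * rF.N)) := fun β R q x η => by
    simp only [hℓdef]
    rw [abs_of_nonneg (Real.sqrt_nonneg _)]
    exact Real.sqrt_le_sqrt ((le_abs_self _).trans (abs_carrierCl_le (r := rF) C one_pos β R q x η))
  -- (EM_Q) for `1·ℓ²` from the rescaled (EM_lin), restricted to β ≥ β₀ and R·uRec β ≤ ℓ₀
  have hEMQ1 := emQ_of_subGaussianLinear rF Transport.uRec (β₁ := β₀) (ℓ₁ := ℓ₀) ℓ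
    (fun β R => Real.sqrt (|β| * (R : ℝ) ^ 4 / |C| * (2 * rF.N))) hℓm hℓb (m := m₁ / Real.sqrt C) (v := v₁ / C) (lam := 1)
    zero_le_one (by linarith)
    (fun β hβ L n q x R hq hR hRa hL hsep T t =>
      hEMC β (hβ₀₁'.trans hβ) L n q x R hq hR (hRa.trans (min_le_right _ _)) hL hsep T t)
  -- convert `1·(√Q)²` to `Q` (β ≥ β₀ ≥ 0)
  have hEMQ : ∀ β : ℝ, β₀ ≤ β → ∀ (L n : ℕ) (q : Fin n → Fin 4 × Fin 4) (x : Fin n → (Fin 4 → ℤ)) (R : ℕ),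
      (∀ i, (q i).1 < (q i).2) → 1 ≤ R → (R : ℝ) * Transport.uRec β ≤ ℓ₀ → 4 * R + 8 ≤ L →
      (∀ i j : Fin n, i ≠ j → ∃ k : Fin 4,
        (2 * (R : ℤ) + 4) ≤ |((((x i k - x j k : ℤ) : ZMod (2 * L + 1))).valMinAbs : ℤ)|) →
      ∀ T : Finset (Fin n),
        torusE (Matrix.specialUnitaryGroup (Fin 2) ℂ) rF β L
          (fun U => Real.exp (((2 : ℕ) : ℝ) * ∑ i ∈ T, Q β R (q i) (x i) U)) ≤
          Real.exp (Real.log (2 * (Real.sqrt (1 / (1 - 4 * (1 * (v₁ / C)))) *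
            Real.exp (2 * 1 * (m₁ / Real.sqrt C) ^ 2 / (1 - 4 * (1 * (v₁ / C)))))) * T.card) := by
    intro β hβ L n q x R hq hR hRa hL hsep T
    have h := hEMQ1 β hβ L n q x R hq hR hRa hL hsep T
    have e : (fun U : LGConfig 4 (Matrix.specialUnitaryGroup (Fin 2) ℂ) =>
        Real.exp (((2 : ℕ) : ℝ) * ∑ i ∈ T, Q β R (q i) (x i) U)) =
        (fun U => Real.exp (((2 : ℕ) : ℝ) * ∑ i ∈ T, 1 * (ℓ β R (q i) (x i) U) ^ 2)) := by
      funext U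
      refine congrArg Real.exp (congrArg _ (Finset.sum_congr rfl fun i _ => ?_))
      simp only [hQdef, hℓdef]
      rw [one_mul, Real.sq_sqrt (carrierCl_nonneg (r := rF) hCpos one_pos (hβ₀0.trans hβ) R (q i) (x i) U)]
    rw [e]
    exact h
  -- (RM) body from the seam reduction: carriers `Q` and `influenceAt`, moments of the latter on reduced families only
  have hRM := responseMoments_of_quadratic_and_reducedLF rF Transport.uRec
    (C₁ := C₁ * C / C_s) (β₁ := β₀) (ℓ₁ := ℓ₀) (A₀ := A₀) (B_LF := B_I) (p := p) Q (influenceAt (N := 2) 𝔟 ε kmax)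
    (fun β R q x => max (|β| * (R : ℝ) ^ 4 / |C| * (2 * rF.N)) (coeffMass 𝔟 (kmax β R) R x))
    (fun β R q x => measurable_carrierCl (r := rF) C 1 β R q x)
    (fun β R q x η => (abs_carrierCl_le (r := rF) C one_pos β R q x η).trans (le_max_left _ _))
    (fun β R q x => measurable_influenceAt (N := 2) 𝔟 ε kmax β R q x)
    (fun β R q x η => (abs_influenceAt_le (N := 2) 𝔟 ε kmax β R q x η).trans (le_max_right _ _))
    (fun β hβ R hR hRa q x hq η => hsplitC β (hβ₀₁.trans hβ) R hR (hRa.trans (min_le_left _ _)) q x hq η)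
    hEMQ
    (fun β hβ L n q x R hq hR hRa hL hred hsep T =>
      hEMIred β (hβ₀₁.trans hβ) L n q x R hq hR (hRa.trans (min_le_left _ _)) hL hred hsep T)
  exact ⟨Transport.uRec, 1, C₁ * C / C_s, _, β₀, ℓ₀, P₀, p, one_pos,
    Filter.Eventually.of_forall fun β => by rw [one_mul], hℓ₀pos, by positivity, hp, hRM⟩

end Summit.QuantumFields.YangMills.Cruxes.UVSeamRec.TemperedResponse

end
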